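import Summits.BirchSwinnertonDyer.BirchSwinnertonDyer.Theorems.PrintCf2SplitBadTwoLocalControlKernelInertia
import Literature.NumberTheory.EllipticCurves.PrimaryTorsionLocalGoodReductionFrobeniusProofs
import Literature.NumberTheory.GaloisRepresentations.HOneRestrictionOntoInvariantsFinite
import HarnessLib

/-!
# Crux `PrintCf2.SplitBadTwoRankOneOfFacts` (stmt-BirchSwinnertonDyer-20368), road α v9.1 — brick B16 file 3:
# the LOCAL KERNEL OF CONTROL VANISHES at every GOOD place `w ∤ 2` of the line (`Frob_w − 1` is onto `W*`)

Cell `bsd-print-cf2`, width seat `bsd-line-cf2-p1-w3` g7 (prover-bsd-line-cf2-p1-w3-g7-0); brick B16 of LEAD g11's 18:21:06Z DE-DUP,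
third file («= 0 at the good `w ∤ 2·7d` where `Frob_w − 1` is surjective on the divisible `W*`»); `--supports stmt-BirchSwinnertonDyer-20368`
(helper, Theses-free). HONEST FRAMING: nothing here closes the crux or a registered stub; BSD is not proved by any of this; no summit
statement is proved by this seat. No definition, no named fact, no `sorry`.

WHAT. File 2 (`…LocalControlKernelInertia`) bounded the local kernel `ker (H¹(H_0 ⊓ D_w, M) → H¹(H_∞ ⊓ D_w, M))` of -w7's control
skeleton by `#M^{I_w}` whenever `I_w ≤ ker κ`. At a GOOD place `w ∤ p` the inertia acts TRIVIALLY on `E[p^∞]` (Silverman VII.4.1(b),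
tree `smul_eq_of_mem_absInertia_of_hasGoodReductionAt`), so `M^{I_w} = M` is infinite and the bound of file 2 is void; instead the
inflation–restriction target `M^{I_w}/(F − 1)M^{I_w}` is ZERO because `F − 1` is ONTO for an arithmetic Frobenius `F`
(tree `primaryTorsionGaloisRep_sub_self_surjective_of_isFrobPow`: `(F − 1)(F − (a_w − 1)) = −#Ẽ_w(k_w)` on the divisible `E[p^∞]`):
* §1 `exists_frobPow_generator_decomp` — generation of `D_w` by `I_w` and the image of an ARITHMETIC FROBENIUS LIFT `φ`
  (`IsFrobPow φ 1`; density of `⟨φ̄⟩` in `Γ_{K_w}/I_{K_w}`, tree `dense_zpowers_mk_absInertia_of_isFrobPow`) — the `IsFrobPow` twin of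
  file 2's `exists_generator_decomp`; `ker_resOfLe_le_subgroupResKer_inertia` — the local kernel lies in `ker (H¹(H_0 ⊓ D_w, M) → H¹(I_w, M))`
  (file 2's transport, as a lemma); `smul_eq_self_of_mem_inertia_of_hasGoodReductionAt` — `I_w` fixes `E[p^∞]` pointwise at a good
  `w ∤ p` (`GreenbergSelmer.inertia` currency).
* §2 **`localControlKer_eq_bot_of_surjective`** — GENERIC VANISHING: `M` any discrete `Γ_K`-module with continuous orbits on which `I_w`
  acts trivially and `F − 1` is onto for the Frobenius image `F` of §1 ⟹ the local kernel at `w` (layer `0`) is `⊥`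
  (`ResKernel.finite_subgroupResKer` with a ONE-element quotient `M/(F − 1)M`).
* §3 ROAD α: `exists_smul_sub_eq_endEigenPrimaryTorsion` — `F − 1` is onto the CM summand `W* = ↥((W.baseChange K).endEigenPrimaryTorsion 2 π r)`
  at a good `w ∤ 2` (onto `E[2^∞]`, then project along `E[2^∞] = W* ⊕ W'`, both `Γ_K`-stable); **`localControlKer_eq_bot_of_hasGoodReductionAt`**
  — for EVERY `ℤ₂`-extension `κ` of `K` with `I_w ≤ ker κ` and every GOOD place `w ∤ 2` of `W_K`, the local kernel of control for `W*`
  at `w` VANISHES; `…_of_frame` (S3c₂ frame, no `θ`-binder, `w ≠ v̄` good). With file 2: away from `2`, the cokernel of Agboola's control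
  map receives contributions ONLY from the additive places `w ∣ 7d`, each of order `≤ 2`.
presearch: Greenberg LNM 1716 §3 Lemma 3.3 ("if `E` has good reduction at `v`, then `ker(r_{v_n}) = 0`", PDF p. 86–87) — held; tree: the
`E[p^∞]`/`localTowerKer` version `Greenberg1999.localTowerKerPrimary_eq_bot_of_hasGoodReductionAt`; here for a `Γ_K`-stable summand in
-w7's `Γ_K`-subgroup currency. beyond-print theorem: no.

References: [GreenbergLNM1716] §3 Lemmas 3.1–3.3 (PDF pp. 86–88), §2 (p. 70); [SilvermanAEC2009] Prop. VII.4.1(b), C.21 Remark 21.3;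
[Agboola2007] §3 Prop. 3.2; [NeukirchSchmidtWingberg2008] Thm. 7.5.3; [Rubin1999] §2.
-/

noncomputable section

open scoped Classical NNReal

set_option linter.dupNamespace false
set_option autoImplicit false

open NumberField IsDedekindDomain Field WeierstrassCurve
open Literature.NumberTheory.EllipticCurves Literature.NumberTheory.EllipticCurves.GreenbergSelmer
open Literature.NumberTheory.EllipticCurves.Agboola2007
open Literature.NumberTheory.EllipticCurves.IwasawaDual
open Literature.NumberTheory.EllipticCurves.ResKernel
open Literature.NumberTheory.GaloisRepresentations
open IsDedekindDomain.HeightOneSpectrum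

universe u

namespace Summit.BirchSwinnertonDyer.BirchSwinnertonDyer.Theorems.PrintCf2.RestrictedSelmerPair

/-! ## §1. Generation by inertia and an arithmetic Frobenius lift; the local kernel dies on inertia -/

section Generation

variable {K : Type u} [Field K] [NumberField K] (w : HeightOneSpectrum (𝓞 K))

/-- **`D_w` is topologically generated by `I_w` and the image of any arithmetic Frobenius lift** (`IsFrobPow φ 1` currency): for a
subgroup `D` squeezed onto `decomp w` there is `φ ∈ Γ_{K_w}` with `IsFrobPow φ 1` whose image `F ∈ D` together with
`I_w = (inertia w).subgroupOf D` generates `↥D` topologically — every open subgroup containing both is `⊤`. Proof: pull back to `Γ_{K_w}`;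
an open subgroup `U' ⊇ I_{K_w}` with `φ ∈ U'` has open (hence closed) image in `Γ_{K_w}/I_{K_w} ≅ Ẑ` containing the dense `⟨φ̄⟩`
(`dense_zpowers_mk_absInertia_of_isFrobPow`). [cite: NeukirchSchmidtWingberg2008, Thm. 7.5.3] [cite: NeukirchANT1999, Ch. II §9 (9.9)] -/
theorem exists_frobPow_generator_decomp {D : Subgroup (absoluteGaloisGroup K)} (hD : D ≤ decomp w) (hD' : decomp w ≤ D) :
    ∃ φ : absoluteGaloisGroup (w.adicCompletion K), IsFrobPow φ 1 ∧
      ∃ hF : absGaloisRestrict K (w.adicCompletion K) φ ∈ D,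
        ∀ U : Subgroup ↥D, IsOpen (U : Set ↥D) → (GreenbergSelmer.inertia w).subgroupOf D ≤ U →
          (⟨absGaloisRestrict K (w.adicCompletion K) φ, hF⟩ : ↥D) ∈ U → U = ⊤ := by
  obtain ⟨φ, hφ⟩ := exists_isFrobPow_holds (F := w.adicCompletion K) 1
  let f : absoluteGaloisGroup (w.adicCompletion K) →* ↥D :=
    (absGaloisRestrict K (w.adicCompletion K)).toMonoidHom.codRestrict D (fun σ ↦ hD' ⟨σ, rfl⟩)
  have hfc : Continuous f := (absGaloisRestrict K (w.adicCompletion K)).continuous.subtype_mk _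
  refine ⟨φ, hφ, hD' ⟨φ, rfl⟩, fun U hU hIU hFU ↦ ?_⟩
  -- pull back to `Γ_{K_w}`
  set U' : Subgroup (absoluteGaloisGroup (w.adicCompletion K)) := U.comap f with hU'_def
  have hU'o : IsOpen (U' : Set (absoluteGaloisGroup (w.adicCompletion K))) := hU.preimage hfc
  have hIU' : absInertia (w.adicCompletion K) ≤ U' := fun σ hσ ↦ by
    refine Subgroup.mem_comap.mpr (hIU ?_)
    rw [Subgroup.mem_subgroupOf]
    exact Subgroup.mem_map.mpr ⟨σ, hσ, rfl⟩
  have hφU' : φ ∈ U' := Subgroup.mem_comap.mpr hFU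
  -- the image of `U'` in `Γ_{K_w} ⧸ I` is an open, hence closed, subgroup containing the dense `⟨φ̄⟩`: it is everything
  set Q := absoluteGaloisGroup (w.adicCompletion K) ⧸ absInertia (w.adicCompletion K)
  set S : Subgroup Q := U'.map (QuotientGroup.mk' (absInertia (w.adicCompletion K))) with hS_def
  have hSo : IsOpen (S : Set Q) := QuotientGroup.isOpenMap_coe _ hU'o
  have hSc : IsClosed (S : Set Q) := Subgroup.isClosed_of_isOpen S hSo
  have hzp : (Subgroup.zpowers (QuotientGroup.mk φ : Q) : Set Q) ⊆ S := by
    intro q hq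
    obtain ⟨k, rfl⟩ := Subgroup.mem_zpowers_iff.mp hq
    exact ⟨φ ^ k, U'.zpow_mem hφU' k, by rw [map_zpow]; rfl⟩
  have hSuniv : (S : Set Q) = Set.univ := by
    have hd := (dense_zpowers_mk_absInertia_of_isFrobPow (F := w.adicCompletion K) hφ).closure_eq
    have h1 : closure (Subgroup.zpowers (QuotientGroup.mk φ : Q) : Set Q) ⊆ S := hSc.closure_subset_iff.mpr hzp
    rw [hd] at h1
    exact Set.eq_univ_of_univ_subset h1
  have hU'top : U' = ⊤ := by
    rw [eq_top_iff]
    intro g _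
    have hg : (QuotientGroup.mk g : Q) ∈ (S : Set Q) := by rw [hSuniv]; trivial
    obtain ⟨u, hu, hug⟩ := Subgroup.mem_map.mp hg
    have hmem : u⁻¹ * g ∈ absInertia (w.adicCompletion K) := by
      rw [← QuotientGroup.eq]
      exact hug
    have := U'.mul_mem hu (hIU' hmem)
    rwa [mul_inv_cancel_left] at this
  -- conclude in `↥D`
  rw [eq_top_iff]
  rintro ⟨g, hg⟩ -
  obtain ⟨σ, hσ⟩ := (mem_decomp_iff w g).mp (hD hg)
  have hσU : σ ∈ U' := hU'top ▸ Subgroup.mem_top σ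
  have hfσ : f σ = ⟨g, hg⟩ := Subtype.ext hσ
  exact hfσ ▸ Subgroup.mem_comap.mp hσU

end Generation

section Generic

variable {K : Type u} [Field K] [NumberField K] {p : ℕ} [Fact p.Prime] (κ : ZpExtension K p)
  (M : Type u) [AddCommGroup M] [DistribMulAction (absoluteGaloisGroup K) M]
  [TopologicalSpace M] [DiscreteTopology M] (w : HeightOneSpectrum (𝓞 K))

/-- **The local kernel of control dies on inertia**: for `I_w ≤ ker κ`, the layer-`0` local kernel
`ker (H¹(H_0 ⊓ D_w, M) → H¹(H_∞ ⊓ D_w, M))` lies in `ker (H¹(H_0 ⊓ D_w, M) → H¹(I_w, M))` (= the tree's `subgroupResKer` of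
`(inertia w).subgroupOf (H_0 ⊓ D_w)`), since `I_w ≤ H_∞ ⊓ D_w` (functoriality `resH1Hom_comp`). The transport step of file 2 as a lemma.
[cite: GreenbergLNM1716, §3 Lemma 3.3 (proof, p. 87)] [cite: NeukirchSchmidtWingberg2008, I.§5] -/
theorem ker_resOfLe_le_subgroupResKer_inertia (hI : GreenbergSelmer.inertia w ≤ κ.kerSubgroup) :
    (resOfLe M (inf_le_inf_right (decomp w) (κ.kerSubgroup_le_layerSubgroup 0) :
        κ.kerSubgroup ⊓ decomp w ≤ κ.layerSubgroup 0 ⊓ decomp w)).ker ≤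
      subgroupResKer M ((GreenbergSelmer.inertia w).subgroupOf (κ.layerSubgroup 0 ⊓ decomp w)) := by
  intro c hc
  let j : ↥((GreenbergSelmer.inertia w).subgroupOf (κ.layerSubgroup 0 ⊓ decomp w)) →ₜ* ↥(κ.kerSubgroup ⊓ decomp w) :=
    { toFun := fun x ↦ ⟨((x : ↥(κ.layerSubgroup 0 ⊓ decomp w)) : absoluteGaloisGroup K),
        ⟨hI (Subgroup.mem_subgroupOf.mp x.2), (x : ↥(κ.layerSubgroup 0 ⊓ decomp w)).2.2⟩⟩
      map_one' := rfl
      map_mul' := fun _ _ ↦ rfl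
      continuous_toFun := (continuous_subtype_val.comp continuous_subtype_val).subtype_mk _ }
  have hcomp : (resH1Hom j (AddMonoidHom.id M) (fun _ _ ↦ rfl)).comp
      (resOfLe M (inf_le_inf_right (decomp w) (κ.kerSubgroup_le_layerSubgroup 0) :
        κ.kerSubgroup ⊓ decomp w ≤ κ.layerSubgroup 0 ⊓ decomp w)) =
      resSubgroup ((GreenbergSelmer.inertia w).subgroupOf (κ.layerSubgroup 0 ⊓ decomp w)) M := by
    unfold Literature.NumberTheory.EllipticCurves.resOfLe ResKernel.resSubgroup
    rw [resH1Hom_comp]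
    exact resH1Hom_congr (ContinuousMonoidHom.ext fun _ ↦ rfl) (AddMonoidHom.ext fun _ ↦ rfl) _ _
  rw [mem_subgroupResKer_iff, ← hcomp, AddMonoidHom.comp_apply, (AddMonoidHom.mem_ker).mp hc, map_zero]

/-- **GENERIC VANISHING OF THE LOCAL KERNEL.** `κ` a `ℤ_p`-extension of a number field `K`, `M` a discrete `Γ_K`-module with
continuous orbit maps, `w` a finite place with `I_w ≤ ker κ` acting TRIVIALLY on `M`, and suppose `F − 1` is ONTO `M` for the
image `F ∈ Γ_K` of an arithmetic Frobenius lift `φ ∈ Γ_{K_w}` (for EVERY such `φ`). Then the layer-`0` local kernel of control at `w`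
is `⊥`: it embeds into `M^{I_w}/(F − 1)M^{I_w} = M/(F − 1)M = 0` (`ResKernel.finite_subgroupResKer` in `↥(H_0 ⊓ D_w)`, §1).
[cite: GreenbergLNM1716, §3 Lemma 3.3 (p. 87: "`B_v` is divisible … `ker(r_{v_n}) = 0`")] [cite: SerreLocalFields1979, XIII §1 Prop. 1] -/
theorem localControlKer_eq_bot_of_surjective (hI : GreenbergSelmer.inertia w ≤ κ.kerSubgroup)
    (hcont : ∀ m : M, Continuous fun g : absoluteGaloisGroup K ↦ g • m)
    (hfix : ∀ τ ∈ GreenbergSelmer.inertia w, ∀ m : M, τ • m = m)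
    (hsurj : ∀ φ : absoluteGaloisGroup (w.adicCompletion K), IsFrobPow φ 1 →
      ∀ m : M, ∃ y : M, absGaloisRestrict K (w.adicCompletion K) φ • y - y = m) :
    (resOfLe M (inf_le_inf_right (decomp w) (κ.kerSubgroup_le_layerSubgroup 0) :
        κ.kerSubgroup ⊓ decomp w ≤ κ.layerSubgroup 0 ⊓ decomp w)).ker = ⊥ := by
  let G₀ : Subgroup (absoluteGaloisGroup K) := κ.layerSubgroup 0 ⊓ decomp w
  have hG₀D : G₀ ≤ decomp w := inf_le_right
  have hDG₀ : decomp w ≤ G₀ := fun g hg ↦ ⟨by rw [ZpExtension.layerSubgroup_zero]; trivial, hg⟩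
  let N : Subgroup ↥G₀ := (GreenbergSelmer.inertia w).subgroupOf G₀
  haveI : N.Normal := normal_inertia_subgroupOf w hG₀D
  obtain ⟨φ, hφ, hFD, hgen⟩ := exists_frobPow_generator_decomp w hG₀D hDG₀
  set F : ↥G₀ := ⟨absGaloisRestrict K (w.adicCompletion K) φ, hFD⟩ with hF_def
  have hcont' : ∀ m : M, Continuous fun g : ↥G₀ ↦ g • m := fun m ↦ (hcont m).comp continuous_subtype_val
  -- every element of `M` is `N`-fixed, and `F − 1` is onto the fixed module: the quotient is a point
  have hall : ∀ m : M, m ∈ FixedPoints.addSubgroup N M := fun m ↦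
    (FixedPoints.mem_addSubgroup _ _ m).mpr fun x ↦ hfix _ (Subgroup.mem_subgroupOf.mp x.2) m
  have hrange : (subOne N M F).range = ⊤ := by
    rw [eq_top_iff]
    rintro m -
    obtain ⟨y, hy⟩ := hsurj φ hφ (m : M)
    refine ⟨⟨y, hall y⟩, Subtype.ext ?_⟩
    rw [coe_subOne_apply]
    exact hy
  haveI : Subsingleton (FixedPoints.addSubgroup N M ⧸ (subOne N M F).range) := by
    rw [hrange]
    exact QuotientAddGroup.subsingleton_quotient_top
  haveI : Finite (FixedPoints.addSubgroup N M ⧸ (subOne N M F).range) := Finite.of_subsingleton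
  obtain ⟨hfinK, hcardK⟩ := ResKernel.finite_subgroupResKer N M F hgen hcont'
  haveI := hfinK
  have hle1 : Nat.card (subgroupResKer M N) ≤ 1 :=
    hcardK.trans (Finite.card_le_one_iff_subsingleton.mpr inferInstance)
  have hbot : subgroupResKer M N = ⊥ := (subgroupResKer M N).eq_bot_of_card_le hle1
  rw [eq_bot_iff, ← hbot]
  exact ker_resOfLe_le_subgroupResKer_inertia κ M w hI

end Generic

/-! ## §2. `E[p^∞]` at a good place `w ∤ p`: inertia acts trivially (`GreenbergSelmer.inertia` currency) -/

section Good

variable {K : Type u} [Field K] [NumberField K] (V : WeierstrassCurve K) [V.IsElliptic] (p : ℕ) [Fact p.Prime]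
  {w : HeightOneSpectrum (𝓞 K)}

omit [Fact p.Prime] in
/-- **`I_w` fixes `E[p^∞]` pointwise at a GOOD place `w ∤ p`** (Silverman VII.4.1(b); the tree's
`smul_eq_of_mem_absInertia_of_hasGoodReductionAt` read with `GreenbergSelmer.inertia w = map (absGaloisRestrict K K_w) (absInertia K_w)`).
[cite: SilvermanAEC2009, Prop. VII.4.1(b)] [cite: NeukirchANT1999, Ch. II §9 Prop. (9.6)] -/
theorem smul_eq_self_of_mem_inertia_of_hasGoodReductionAt (hgood : V.HasGoodReductionAt w)
    (hpw : ((p : ℕ) : 𝓞 K) ∉ w.asIdeal) {τ : absoluteGaloisGroup K} (hτ : τ ∈ GreenbergSelmer.inertia w)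
    (x : V.geomPrimaryTorsion p) : τ • x = x := by
  obtain ⟨σ, hσ, rfl⟩ := Subgroup.mem_map.mp hτ
  obtain ⟨k, hk⟩ := (AddCommGroup.mem_primaryComponent).mp x.2
  have hn : (((p : ℤ) ^ k : ℤ) : 𝓞 K) ∉ w.asIdeal := by
    rw [Int.cast_pow, Int.cast_natCast]
    exact fun h ↦ hpw (w.isPrime.mem_of_pow_mem k h)
  have hP : ((p : ℤ) ^ k) • (x : geomPoints V) = 0 := by
    rw [← Int.natCast_pow, natCast_zsmul]
    exact hk
  refine Subtype.ext ?_
  rw [primaryComponent.coe_smul]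
  exact V.smul_eq_of_mem_absInertia_of_hasGoodReductionAt hgood hn hσ hP

end Good

/-! ## §3. Road α: `F − 1` is onto `W*`, and the local kernel of control vanishes at the good places -/

section CM

open Summit.BirchSwinnertonDyer.BirchSwinnertonDyer.Theorems.PrintCf2.AdditiveAtSeven
open Summit.BirchSwinnertonDyer.BirchSwinnertonDyer.Theorems.PrintCf2.CMPrimes

variable (W : WeierstrassCurve ℚ) [W.IsElliptic] {K : Type} [Field K] [NumberField K]

/-- **`F − 1` IS ONTO THE CM SUMMAND at a good `w ∤ 2`.** `W/ℚ` with `j = −3375`, `θ² = −7` in `K`, `π ∈ End_K(E_K)` with `π² = π − 2`,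
`r² = r − 2`, `w ∤ 2` a place of GOOD reduction of `W_K`, `φ ∈ Γ_{K_w}` an arithmetic Frobenius lift, `F` its image in `Γ_K`: every
`Q ∈ W* = E[𝔮_r^∞]` is `F y − y` for some `y ∈ W*` — `F − 1` is onto `E[2^∞]` (tree, Cayley–Hamilton on the divisible module), and the
`W*`-component of a preimage is a preimage (`E[2^∞] = W* ⊕ W'`, both summands `Γ_K`-stable, `endEigenPrimaryTorsion_two_structure`).
[cite: GreenbergLNM1716, §2 (p. 70) and §3 Lemma 3.3 (p. 87)] [cite: Rubin1999, §2 and Prop. 5.4] -/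
theorem exists_smul_sub_eq_endEigenPrimaryTorsion (hj : W.j = -3375) {θ : K} (hθ : θ ^ 2 = -7)
    (π : (W.baseChange K).endRing) (hrel : (π : AddMonoid.End (W.baseChange K).geomPoints) * π = π - 2)
    {r : ℤ_[2]} (hr : r * r = r - 2) {w : HeightOneSpectrum (𝓞 K)} (h2w : ((2 : ℕ) : 𝓞 K) ∉ w.asIdeal)
    (hgood : (W.baseChange K).HasGoodReductionAt w) {φ : absoluteGaloisGroup (w.adicCompletion K)} (hφ : IsFrobPow φ 1)
    {Q : (W.baseChange K).geomPrimaryTorsion 2} (hQ : Q ∈ (W.baseChange K).endEigenPrimaryTorsion 2 π r) :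
    ∃ y ∈ (W.baseChange K).endEigenPrimaryTorsion 2 π r,
      absGaloisRestrict K (w.adicCompletion K) φ • y - y = Q := by
  haveI : (W.baseChange K).IsElliptic := by rw [baseChange]; infer_instance
  set C := (W.baseChange K).endEigenPrimaryTorsion 2 π r with hC_def
  set C' := (W.baseChange K).endEigenPrimaryTorsion 2 π (1 - r) with hC'_def
  set σF := absGaloisRestrict K (w.adicCompletion K) φ with hσF
  obtain ⟨hinf, hsup, -, -, -, -, -, -⟩ := endEigenPrimaryTorsion_two_structure W hj K hθ π hrel hr
  -- `F − 1` is onto `E[2^∞]`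
  obtain ⟨y, hy⟩ := (W.baseChange K).primaryTorsionGaloisRep_sub_self_surjective_of_isFrobPow 2 h2w hgood hφ
    (show PrimaryTorsion (geomPoints (W.baseChange K)) 2 from Q)
  -- read `y` in `E[2^∞] = ↥(geomPrimaryTorsion 2)` (same carrier) and the equation on points
  have hyQ : σF • (show (W.baseChange K).geomPrimaryTorsion 2 from y) - (show (W.baseChange K).geomPrimaryTorsion 2 from y) = Q := by
    refine Subtype.ext ?_
    have h := congrArg (fun z : PrimaryTorsion (geomPoints (W.baseChange K)) 2 ↦ (z : geomPoints (W.baseChange K))) hy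
    exact h
  set yg : (W.baseChange K).geomPrimaryTorsion 2 := (show (W.baseChange K).geomPrimaryTorsion 2 from y) with hyg
  -- decompose `yg = y₁ + y₂` along `C ⊔ C' = ⊤`
  have hmem : yg ∈ C ⊔ C' := by rw [hsup]; exact AddSubgroup.mem_top _
  obtain ⟨y₁, hy₁, y₂, hy₂, hsum⟩ := AddSubgroup.mem_sup.mp hmem
  have ha₁ : σF • y₁ - y₁ ∈ C := C.sub_mem (smul_mem_endEigenPrimaryTorsion π r σF hy₁) hy₁
  have ha₂ : σF • y₂ - y₂ ∈ C' := C'.sub_mem (smul_mem_endEigenPrimaryTorsion π (1 - r) σF hy₂) hy₂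
  have hdec : Q = (σF • y₁ - y₁) + (σF • y₂ - y₂) := by
    rw [← hyQ, ← hsum, smul_add]
    abel
  -- the `C'`-component vanishes
  have ha₂C : σF • y₂ - y₂ ∈ C := by
    have : σF • y₂ - y₂ = Q - (σF • y₁ - y₁) := by rw [hdec]; abel
    rw [this]
    exact C.sub_mem hQ ha₁
  have hzero : σF • y₂ - y₂ = 0 := by
    have h : σF • y₂ - y₂ ∈ C ⊓ C' := ⟨ha₂C, ha₂⟩
    rw [hinf] at h
    exact (AddSubgroup.mem_bot).mp h
  refine ⟨y₁, hy₁, ?_⟩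
  rw [hdec, hzero, add_zero]

/-- **THE LOCAL KERNEL OF CONTROL FOR `W*` VANISHES AT EVERY GOOD PLACE `w ∤ 2` OF THE LINE.** `W/ℚ` with `j = −3375`, `θ² = −7` in `K`,
`π ∈ End_K(E_K)`, `π² = π − 2`, `r² = r − 2`, `κ` ANY `ℤ₂`-extension of `K`, `w ∤ 2` with `I_w ≤ ker κ` and `W_K` of good reduction at `w`:
`ker (H¹(H_0 ⊓ D_w, W*) → H¹(H_∞ ⊓ D_w, W*)) = ⊥` (§1 with `I_w` trivial on `E[2^∞]` and `F − 1` onto `W*`). Greenberg's "`ker(r_v) = 0`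
at good `v ∤ p`" for the CM summand, in -w7's currency. [cite: GreenbergLNM1716, §3 Lemma 3.3 (p. 86)] [cite: Agboola2007, §3 Prop. 3.2] -/
theorem localControlKer_eq_bot_of_hasGoodReductionAt (hj : W.j = -3375) {θ : K} (hθ : θ ^ 2 = -7)
    (π : (W.baseChange K).endRing) (hrel : (π : AddMonoid.End (W.baseChange K).geomPoints) * π = π - 2)
    {r : ℤ_[2]} (hr : r * r = r - 2) (κ : ZpExtension K 2) {w : HeightOneSpectrum (𝓞 K)}
    (hI : GreenbergSelmer.inertia w ≤ κ.kerSubgroup) (h2w : ((2 : ℕ) : 𝓞 K) ∉ w.asIdeal)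
    (hgood : (W.baseChange K).HasGoodReductionAt w) :
    (resOfLe ↥((W.baseChange K).endEigenPrimaryTorsion 2 π r)
        (inf_le_inf_right (decomp w) (κ.kerSubgroup_le_layerSubgroup 0) :
          κ.kerSubgroup ⊓ decomp w ≤ κ.layerSubgroup 0 ⊓ decomp w)).ker = ⊥ := by
  haveI : (W.baseChange K).IsElliptic := by rw [baseChange]; infer_instance
  refine localControlKer_eq_bot_of_surjective κ ↥((W.baseChange K).endEigenPrimaryTorsion 2 π r) w hI
    (continuous_smul_endEigenPrimaryTorsion (W.baseChange K) 2 π r) (fun τ hτ m ↦ ?_) (fun φ hφ m ↦ ?_)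
  · exact Subtype.ext (smul_eq_self_of_mem_inertia_of_hasGoodReductionAt (W.baseChange K) 2 hgood h2w hτ _)
  · obtain ⟨y, hy, hyeq⟩ := exists_smul_sub_eq_endEigenPrimaryTorsion W hj hθ π hrel hr h2w hgood hφ m.2
    exact ⟨⟨y, hy⟩, Subtype.ext (by
      rw [AddSubgroupClass.coe_sub, endEigenPrimaryTorsion.coe_smul]
      exact hyeq)⟩

/-- **ROAD α, GOOD PLACES OF THE FRAME**: on every S3c₂ frame (member `C • W = cm7^{(d)}`, `K` imaginary quadratic, `v̄ ∣ 2`,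
`π ∈ End_K(E_K)`, `π² = π − 2`, `r² = r − 2`, `κ'` unramified outside `v̄`; no `θ`-binder) the local kernel of control for `W*` VANISHES at
every place `w ≠ v̄`, `w ∤ 2`, of good reduction of `W_K`. So away from `2` only the additive places `w ∣ 7d` contribute to the cokernel of
Agboola's control map, each by a group of order `≤ 2` (file 2). [cite: Agboola2007, §3 Prop. 3.2] [cite: GreenbergLNM1716, §3 Lemma 3.3] -/
theorem localControlKer_eq_bot_of_frame_of_hasGoodReductionAt {d : ℤ} (hd0 : d ≠ 0) (W : WeierstrassCurve ℚ) [W.IsElliptic]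
    (C : VariableChange ℚ) (hC : C • W = cm7.quadraticTwist (d : ℚ))
    (vbar : HeightOneSpectrum (𝓞 K)) (π : (W.baseChange K).endRing)
    (hrel : (π : AddMonoid.End (W.baseChange K).geomPoints) * π = π - 2)
    {r : ℤ_[2]} (hr : r * r = r - 2) (κ' : ZpExtension K 2) (hκ' : κ'.IsUnramifiedOutside vbar)
    {w : HeightOneSpectrum (𝓞 K)} (hw : w ≠ vbar) (h2w : ((2 : ℕ) : 𝓞 K) ∉ w.asIdeal)
    (hgood : (W.baseChange K).HasGoodReductionAt w) :
    (resOfLe ↥((W.baseChange K).endEigenPrimaryTorsion 2 π r)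
        (inf_le_inf_right (decomp w) (κ'.kerSubgroup_le_layerSubgroup 0) :
          κ'.kerSubgroup ⊓ decomp w ≤ κ'.layerSubgroup 0 ⊓ decomp w)).ker = ⊥ := by
  have hj : W.j = -3375 := j_eq_of_smul_eq_cm7Twist hd0 W C hC
  obtain ⟨θ, hθ⟩ := exists_sq_eq_neg_seven_of_cmEndo_mem_endRing W K hj π hrel
  exact localControlKer_eq_bot_of_hasGoodReductionAt W hj hθ π hrel hr κ' (hκ' w hw) h2w hgood

end CM

end Summit.BirchSwinnertonDyer.BirchSwinnertonDyer.Theorems.PrintCf2.RestrictedSelmerPair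

end
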